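import Summits.Ventures.LatticeQCDFlow.Scaling.OneSidedHubFloor

/-!
HONEST FRAMING: exact (Metropolis-corrected) sampling algorithms for lattice gauge theory; figures
of merit are autocorrelation/cost numbers at stated couplings and volumes; no continuum-physics
claim.

# SwapGraphDilution — THE EDGE COUNT IS THE RATE: FOR EVERY SWAP GRAPH OF `m` EDGES, `h` OF THEM AT THE HOT
# REPLICA, AND EVERY ALLOCATION OF THE UPDATES, `Gap ≤ t·h·min{μ_0(A), μ_0(Aᶜ)}/(m·K·v)` OVER SECTOR-IDLE COLD
# REPLICAS; ON A SIMPLE GRAPH CONTAINING THE HUB, HOT-ONLY UPDATES AND ONE-SIDED DOMINATION: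
# `p·min{t/(6m), γ₀(1−t)/(14K)} ≤ Gap ≤ t·min{μ_0(A), μ_0(Aᶜ)}/(m·v)`; THE COMPLETE GRAPH IS ORDER `K⁻²`, TWO-SIDED
# (lean-2 GEN-23, ours)

Venture-side (OURS).  Cell `lqcd-flow` (pub-lqcd), unit `pub-lqcd-lean-2-g23`, 2026-08-26.  Chapter K (the swap
graph and the proposal law), file 1.  Setting of chapters G–J: state space `Fin (K+1) → S`, product law
`π̃ = ⊗μ_k` (`tensorFun μ`), the weighted exchange scheme `P = t·ptGraphSwap μ e φ + (1−t)·prodKernel w M` over an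
edge list `e : Fin m → Fin (K+1) × Fin (K+1)` (distinct endpoints, one entry drawn uniformly per swap step, maps
`φ_r`, Metropolis-corrected; `Scaling/ReplicaExchangeGraphSwap`), update weights `w` (`Scaling/WeightedHubSchemeFloor`,
`Scaling/ExchangeSchemeHandoverCeiling`).  `h` = the number of list entries with an endpoint at the hot level `0`
(the HOT DEGREE, with multiplicity).  `Scaling/ReplicaExchangeGraphSwapDiffusive` (G2) proved `Gap ≤ t·h·d/(2mKv)`
for the UNIFORM update schedule; `Scaling/OneSidedHubFloor` (J8) proved the floor `p·min{t/(6m), γ₀(1−t)w_0/(14K)}`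
for every graph containing the hub.  This file frees the ceiling from the update schedule through the handover
identity of `Scaling/ExchangeSchemeHandoverCeiling` (H1) and closes the two on simple graphs.

## What is proved

* §1 **`ptGraphSwap_sectorCount_eq`** — sector-preserving maps (`φ_r u ∈ A ↔ u ∈ A`) keep every sector count on
  every graph; **`ptGraphSwap_handoverFlow_le`** / **`_compl`** — THE HANDOVER FLOW OF THE GRAPH SWAP IS DILUTED:
  `η ≤ (h/m)·μ_0(A)` and `η ≤ (h/m)·μ_0(Aᶜ)` (any maps): only an entry touching level `0` can change the hot
  replica's sector, and each is drawn with probability `1/m`.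
* §2 **`dilutedHandover_spectralGap_le`** — for EVERY weights `w` and sector-IDLE cold replicas
  (`w_k·Q_k(A,Aᶜ) = 0` for `k ≠ 0`: frozen, or never updated), `μ_k(A)μ_k(Aᶜ) ≥ v > 0` (`k ≠ 0`), `K, m ≥ 1`:
  **`Gap(P) ≤ t·h·min{μ_0(A), μ_0(Aᶜ)}/(m·K·v)`**.
* §3 **`hotDegree_le_of_simple`** — an edge list without repeated pairs has `h ≤ K`;
  **`simpleGraph_spectralGap_le`** — hence `Gap(P) ≤ t·min{μ_0(A), μ_0(Aᶜ)}/(m·v)` on every simple swap graph.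
* §4 **`simpleHubGraph_spectralGap_two_sided` (THE DILUTION LAW)** — simple graph containing the hub edges
  `(0, k+1)`, identity maps, hot-only updates (`w = 𝟙_{k=0}`), hot Poincaré constant `γ₀`, one-sided domination
  `p·μ_{k+1} ≤ μ_0`, a sector `A` with `μ_k(A)μ_k(Aᶜ) ≥ v` at the cold levels:
  **`p·min{t/(6m), γ₀(1−t)/(14K)} ≤ Gap(P) ≤ t·min{μ_0(A), μ_0(Aᶜ)}/(m·v)`** — matched in `m`;
  **`completeGraph_spectralGap_two_sided`** — `2m = K(K+1)` (the complete graph):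
  `p·min{t/(3K(K+1)), γ₀(1−t)/(14K)} ≤ Gap(P) ≤ 2t·min{μ_0(A), μ_0(Aᶜ)}/(K(K+1)·v)` — ORDER `K⁻²`, TWO-SIDED.

Reading (no numerics implied): with one tunnelling replica, every swap proposal spent on a pair of cold replicas is
lost for relaxation — it permutes stale configurations —, so drawing the pair uniformly from a graph of `m` edges
slows the hot-only hub's order-`K` law (`Scaling/OneSidedHubFloor`, `m = K`) to order `m` exactly: the complete
graph ("swap any two replicas") is quadratic in the number of replicas, from both sides, under the same one-sided
domination that makes the star linear.  NOT CLAIMED: non-uniform proposal laws over the edges (the sequel treats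
multiplicities); cold replicas that relax within sectors (then `Scaling/HubModeAllocation`'s `K/m` dilution);
continuous spaces; anything measured.  Literature grade (cell rule): KNOWN MECHANISM (test-function ceilings,
Levin–Peres–Wilmer §13.2), NEW TYPING; nothing cited as a fact; no new bib keys.
-/

noncomputable section

open Finset Function
open Literature.Probability.MarkovChains

namespace Summit.Ventures.LatticeQCDFlow.Scaling

variable {S : Type*} [Fintype S] [DecidableEq S] {K m : ℕ} {μ : Fin (K + 1) → S → ℝ}
  {M : Fin (K + 1) → S → S → ℝ} {w : Fin (K + 1) → ℝ} {t : ℝ} {e : Fin m → Fin (K + 1) × Fin (K + 1)}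
  {φ : Fin m → Equiv.Perm S}

/-! ## §1 Sector counts and the handover flow of the graph swap -/

/-- **Sector-preserving maps keep every sector count on every swap graph:** if `φ_r u ∈ A ↔ u ∈ A` for all `r`
(edges with distinct endpoints, positive laws), `GSw(x,y) ≠ 0 ⇒ #{i : y_i ∈ A} = #{i : x_i ∈ A}`. [ours] -/
theorem ptGraphSwap_sectorCount_eq (he : ∀ r, (e r).1 ≠ (e r).2) (hμ : ∀ k x, 0 < μ k x) {A : Finset S}
    (hφA : ∀ r u, φ r u ∈ A ↔ u ∈ A) (x y : Fin (K + 1) → S) (hxy : ptGraphSwap μ e φ x y ≠ 0) :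
    ∑ i, (if y i ∈ A then (1 : ℝ) else 0) = ∑ i, (if x i ∈ A then (1 : ℝ) else 0) := by
  rcases ptGraphSwap_ne_zero he hμ hxy with h | ⟨r, hr⟩
  · rw [h]
  · have hφA' : ∀ u, (φ r).symm u ∈ A ↔ u ∈ A := fun u => by
      have := hφA r ((φ r).symm u); rw [Equiv.apply_symm_apply] at this; exact this.symm
    rw [hr]
    have hcoord : ∀ i, (if edgeFlowSwap (φ r) (e r).1 (e r).2 x i ∈ A then (1 : ℝ) else 0)
        = (if x (Equiv.swap (e r).1 (e r).2 i) ∈ A then (1 : ℝ) else 0) := by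
      intro i
      by_cases h1 : i = (e r).1
      · subst h1; rw [edgeFlowSwap_fst _ (he r), Equiv.swap_apply_left]; exact if_congr (hφA' _) rfl rfl
      · by_cases h2 : i = (e r).2
        · subst h2; rw [edgeFlowSwap_snd, Equiv.swap_apply_right]; exact if_congr (hφA r _) rfl rfl
        · rw [edgeFlowSwap_of_ne _ _ _ _ h1 h2, Equiv.swap_apply_of_ne_of_ne h1 h2]
    simp_rw [hcoord]
    exact Equiv.sum_comp (Equiv.swap (e r).1 (e r).2) (fun i => if x i ∈ A then (1 : ℝ) else 0)

/-- **THE HANDOVER FLOW OF THE GRAPH SWAP IS DILUTED: `η ≤ (h/m)·μ_0(A)`** — the stationary flow of the graph swap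
out of `{x : x_0 ∈ A}` is at most the hot sector's mass times the probability `h/m` that the drawn entry touches the
hot level (any maps, any edge list). [ours] -/
theorem ptGraphSwap_handoverFlow_le (hμ : ∀ k x, 0 < μ k x) (hμ1 : ∀ k, ∑ u, μ k u = 1) (A : Finset S) :
    edgeMeasure (tensorFun μ) (ptGraphSwap μ e φ) (univ.filter (fun x : Fin (K + 1) → S => x 0 ∈ A))
        (univ.filter (fun x : Fin (K + 1) → S => x 0 ∈ A))ᶜ
      ≤ ((univ.filter fun r : Fin m => (e r).1 = 0 ∨ (e r).2 = 0).card : ℝ) / m * ∑ u ∈ A, μ 0 u := by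
  set B := univ.filter (fun x : Fin (K + 1) → S => x 0 ∈ A) with hB
  set H := univ.filter (fun r : Fin m => (e r).1 = 0 ∨ (e r).2 = 0) with hH
  -- one row: the swap leaves `B` only through an entry touching level `0`
  have hrow : ∀ x ∈ B, ∑ y ∈ Bᶜ, tensorFun μ x * ptGraphSwap μ e φ x y ≤ tensorFun μ x * ((H.card : ℝ) / m) := by
    intro x hx
    rw [← Finset.mul_sum]
    refine mul_le_mul_of_nonneg_left ?_ (tensorFun_pos hμ x).le
    have hx0 : x 0 ∈ A := (Finset.mem_filter.mp hx).2
    calc ∑ y ∈ Bᶜ, ptGraphSwap μ e φ x y ≤ ∑ y ∈ Bᶜ, ptGraphProposal e φ x y := by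
          refine sum_le_sum fun y hy => ?_
          have hxy : x ≠ y := fun h => (Finset.mem_compl.mp hy) (h ▸ hx)
          exact mhKernel_le_of_ne _ _ hxy
      _ = ∑ r : Fin m, ∑ y ∈ Bᶜ, (if y = edgeFlowSwap (φ r) (e r).1 (e r).2 x then (1 : ℝ) / m else 0) := by
          unfold ptGraphProposal; rw [Finset.sum_comm]
      _ ≤ ∑ r : Fin m, (if r ∈ H then (1 : ℝ) / m else 0) := by
          refine sum_le_sum fun r _ => ?_
          rw [Finset.sum_ite_eq' Bᶜ (edgeFlowSwap (φ r) (e r).1 (e r).2 x) (fun _ => (1 : ℝ) / m)]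
          by_cases hr : r ∈ H
          · rw [if_pos hr]
            split_ifs
            · exact le_rfl
            · positivity
          · have hr' : (e r).1 ≠ 0 ∧ (e r).2 ≠ 0 :=
              not_or.mp fun h' => hr (Finset.mem_filter.mpr ⟨mem_univ _, h'⟩)
            have hz : edgeFlowSwap (φ r) (e r).1 (e r).2 x ∈ B := by
              refine Finset.mem_filter.mpr ⟨mem_univ _, ?_⟩
              rw [edgeFlowSwap_of_ne _ _ _ _ (Ne.symm hr'.1) (Ne.symm hr'.2)]; exact hx0
            rw [if_neg (fun h' => (Finset.mem_compl.mp h') hz), if_neg hr]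
      _ = (H.card : ℝ) / m := by
          rw [Finset.sum_ite_mem, Finset.univ_inter, Finset.sum_const, nsmul_eq_mul, mul_one_div]
  unfold edgeMeasure
  calc ∑ x ∈ B, ∑ y ∈ Bᶜ, tensorFun μ x * ptGraphSwap μ e φ x y ≤ ∑ x ∈ B, tensorFun μ x * ((H.card : ℝ) / m) :=
        sum_le_sum hrow
    _ = (H.card : ℝ) / m * ∑ u ∈ A, μ 0 u := by rw [← Finset.sum_mul, mul_comm, hB, tensorFun_mass_hotSector hμ1 A]

/-- **… and `η ≤ (h/m)·μ_0(Aᶜ)`** (the flow out of a set equals the flow into it at stationarity). [ours] -/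
theorem ptGraphSwap_handoverFlow_le_compl (hμ : ∀ k x, 0 < μ k x) (hμ1 : ∀ k, ∑ u, μ k u = 1) (A : Finset S) :
    edgeMeasure (tensorFun μ) (ptGraphSwap μ e φ) (univ.filter (fun x : Fin (K + 1) → S => x 0 ∈ A))
        (univ.filter (fun x : Fin (K + 1) → S => x 0 ∈ A))ᶜ
      ≤ ((univ.filter fun r : Fin m => (e r).1 = 0 ∨ (e r).2 = 0).card : ℝ) / m * ∑ u ∈ Aᶜ, μ 0 u := by
  have hQ := ptGraphSwap_isRowStochastic (e := e) (φ := φ) hμ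
  have hQrev := ptGraphSwap_detailedBalance (e := e) (φ := φ) hμ
  have hc : (univ.filter (fun x : Fin (K + 1) → S => x 0 ∈ A))ᶜ = univ.filter (fun x : Fin (K + 1) → S => x 0 ∈ Aᶜ) := by
    rw [Finset.compl_filter]; exact Finset.filter_congr fun x _ => by rw [Finset.mem_compl]
  rw [edgeMeasure_compl_comm hQ (hQrev.isStationary hQ.2), hc]
  have h := ptGraphSwap_handoverFlow_le (e := e) (φ := φ) hμ hμ1 Aᶜ
  rw [← hc, compl_compl] at h
  rw [← hc]
  exact h

/-! ## §2 The diluted handover ceiling — every allocation of the updates -/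

/-- **THE DILUTED HANDOVER CEILING:** `0 ≤ t ≤ 1`, `w` a probability vector, sector-preserving maps, sector-IDLE cold
replicas (`w_k·Q_k(A,Aᶜ) = 0` for `k ≠ 0`: frozen under their own updates, or never updated), `μ_k(A)μ_k(Aᶜ) ≥ v > 0`
for `k ≠ 0`, `K ≥ 1`, `m ≥ 1`, `|S| ≥ 2`:
**`Gap(P) ≤ t·h·min{μ_0(A), μ_0(Aᶜ)}/(m·K·v)`**, `h` the number of entries of `e` touching level `0`. [ours] -/
theorem dilutedHandover_spectralGap_le [Nontrivial S] (hK : 1 ≤ K) (hm : 1 ≤ m) (he : ∀ r, (e r).1 ≠ (e r).2)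
    (hμ : ∀ k x, 0 < μ k x) (hμ1 : ∀ k, ∑ u, μ k u = 1) (hM : ∀ k, IsRowStochastic (M k))
    (hMrev : ∀ k, DetailedBalance (μ k) (M k)) (hw0 : ∀ k, 0 ≤ w k) (hw1 : ∑ k, w k = 1) (ht0 : 0 ≤ t)
    (ht1 : t ≤ 1) {A : Finset S} (hφA : ∀ r u, φ r u ∈ A ↔ u ∈ A) {v : ℝ} (hvpos : 0 < v)
    (hv : ∀ k : Fin (K + 1), k ≠ 0 → v ≤ (∑ u ∈ A, μ k u) * ∑ u ∈ Aᶜ, μ k u)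
    (hidle : ∀ k : Fin (K + 1), k ≠ 0 → w k * edgeMeasure (μ k) (M k) A Aᶜ = 0) :
    spectralGap (tensorFun μ) (fun x y : Fin (K + 1) → S => t * ptGraphSwap μ e φ x y + (1 - t) * prodKernel w M x y)
      ≤ t * ((univ.filter fun r : Fin m => (e r).1 = 0 ∨ (e r).2 = 0).card : ℝ)
          * min (∑ u ∈ A, μ 0 u) (∑ u ∈ Aᶜ, μ 0 u) / (m * K * v) := by
  have hKpos : (0 : ℝ) < K := Nat.cast_pos.mpr (by omega)
  have hmpos : (0 : ℝ) < m := Nat.cast_pos.mpr (by omega)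
  have hQ := ptGraphSwap_isRowStochastic (e := e) (φ := φ) hμ
  have hQrev := ptGraphSwap_detailedBalance (e := e) (φ := φ) hμ
  have hQA := ptGraphSwap_sectorCount_eq (μ := μ) he hμ hφA
  have hVge := coldSectorMass_ge (μ := μ) (A := A) hv
  have h := handover_spectralGap_le (w := w) hμ hμ1 hM hMrev hw0 hw1 ht0 ht1 hQ hQrev hQA
    (lt_of_lt_of_le (mul_pos hKpos hvpos) hVge)
  have hU0 : ∑ k : Fin (K + 1), w k * (if k = 0 then (0 : ℝ) else edgeMeasure (μ k) (M k) A Aᶜ) = 0 :=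
    Finset.sum_eq_zero fun k _ => by
      by_cases hk : k = 0
      · rw [if_pos hk, mul_zero]
      · rw [if_neg hk]; exact hidle k hk
  rw [hU0, mul_zero, add_zero] at h
  set η := edgeMeasure (tensorFun μ) (ptGraphSwap μ e φ) (univ.filter (fun x : Fin (K + 1) → S => x 0 ∈ A))
    (univ.filter (fun x : Fin (K + 1) → S => x 0 ∈ A))ᶜ with hη
  set hdeg : ℝ := ((univ.filter fun r : Fin m => (e r).1 = 0 ∨ (e r).2 = 0).card : ℝ) with hh
  have hη0 : 0 ≤ t * η := mul_nonneg ht0 (edgeMeasure_nonneg (fun x => (tensorFun_pos hμ x).le) hQ.1 _ _)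
  have hηle : η ≤ hdeg / m * min (∑ u ∈ A, μ 0 u) (∑ u ∈ Aᶜ, μ 0 u) := by
    rw [mul_min_of_nonneg _ _ (by positivity : 0 ≤ hdeg / m)]
    exact le_min (ptGraphSwap_handoverFlow_le hμ hμ1 A) (ptGraphSwap_handoverFlow_le_compl hμ hμ1 A)
  calc spectralGap (tensorFun μ) (fun x y : Fin (K + 1) → S =>
          t * ptGraphSwap μ e φ x y + (1 - t) * prodKernel w M x y)
      ≤ t * η / ∑ k : Fin (K + 1), (if k = 0 then (0 : ℝ) else (∑ u ∈ A, μ k u) * ∑ u ∈ Aᶜ, μ k u) := h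
    _ ≤ t * η / (K * v) := div_le_div_of_nonneg_left hη0 (by positivity) hVge
    _ ≤ t * (hdeg / m * min (∑ u ∈ A, μ 0 u) (∑ u ∈ Aᶜ, μ 0 u)) / (K * v) :=
        div_le_div_of_nonneg_right (mul_le_mul_of_nonneg_left hηle ht0) (by positivity)
    _ = t * hdeg * min (∑ u ∈ A, μ 0 u) (∑ u ∈ Aᶜ, μ 0 u) / (m * K * v) := by
        field_simp

/-! ## §3 Simple graphs: `h ≤ K` -/

/-- **A swap graph without repeated pairs has hot degree `h ≤ K`:** the other endpoint of an entry touching level `0`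
determines the entry. [ours] -/
theorem hotDegree_le_of_simple (he : ∀ r, (e r).1 ≠ (e r).2)
    (hsimple : Function.Injective (fun r => ({(e r).1, (e r).2} : Finset (Fin (K + 1))))) :
    (univ.filter fun r : Fin m => (e r).1 = 0 ∨ (e r).2 = 0).card ≤ K := by
  set g : Fin m → Fin (K + 1) := fun r => if (e r).1 = 0 then (e r).2 else (e r).1 with hg
  have hpair : ∀ r, (e r).1 = 0 ∨ (e r).2 = 0 → ({(e r).1, (e r).2} : Finset (Fin (K + 1))) = {0, g r} := by
    intro r hr
    by_cases h1 : (e r).1 = 0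
    · rw [hg]; simp only [h1, if_true]
    · have h2 : (e r).2 = 0 := hr.resolve_left h1
      rw [hg]; simp only [h1, if_false, h2]; exact Finset.pair_comm _ _
  have hmaps : ∀ r ∈ (univ.filter fun r : Fin m => (e r).1 = 0 ∨ (e r).2 = 0), g r ∈ univ.erase (0 : Fin (K + 1)) := by
    intro r hr
    refine Finset.mem_erase.mpr ⟨?_, mem_univ _⟩
    by_cases h1 : (e r).1 = 0
    · rw [hg]; simp only [h1, if_true]; exact fun h2 => he r (h1.trans h2.symm)
    · rw [hg]; simp only [h1, if_false]; exact h1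
  have hinj : Set.InjOn g ↑(univ.filter fun r : Fin m => (e r).1 = 0 ∨ (e r).2 = 0) := by
    intro r hr s hs hgs
    have hr' := (Finset.mem_filter.mp (Finset.mem_coe.mp hr)).2
    have hs' := (Finset.mem_filter.mp (Finset.mem_coe.mp hs)).2
    refine hsimple ?_
    simp only
    rw [hpair r hr', hpair s hs', hgs]
  calc (univ.filter fun r : Fin m => (e r).1 = 0 ∨ (e r).2 = 0).card ≤ (univ.erase (0 : Fin (K + 1))).card :=
        Finset.card_le_card_of_injOn g hmaps hinj
    _ = K := by rw [Finset.card_erase_of_mem (mem_univ _), Finset.card_univ, Fintype.card_fin]; omega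

/-- **EVERY SIMPLE SWAP GRAPH: `Gap(P) ≤ t·min{μ_0(A), μ_0(Aᶜ)}/(m·v)`** (hypotheses of
`dilutedHandover_spectralGap_le`, no repeated pairs). [ours] -/
theorem simpleGraph_spectralGap_le [Nontrivial S] (hK : 1 ≤ K) (hm : 1 ≤ m) (he : ∀ r, (e r).1 ≠ (e r).2)
    (hsimple : Function.Injective (fun r => ({(e r).1, (e r).2} : Finset (Fin (K + 1)))))
    (hμ : ∀ k x, 0 < μ k x) (hμ1 : ∀ k, ∑ u, μ k u = 1) (hM : ∀ k, IsRowStochastic (M k))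
    (hMrev : ∀ k, DetailedBalance (μ k) (M k)) (hw0 : ∀ k, 0 ≤ w k) (hw1 : ∑ k, w k = 1) (ht0 : 0 ≤ t)
    (ht1 : t ≤ 1) {A : Finset S} (hφA : ∀ r u, φ r u ∈ A ↔ u ∈ A) {v : ℝ} (hvpos : 0 < v)
    (hv : ∀ k : Fin (K + 1), k ≠ 0 → v ≤ (∑ u ∈ A, μ k u) * ∑ u ∈ Aᶜ, μ k u)
    (hidle : ∀ k : Fin (K + 1), k ≠ 0 → w k * edgeMeasure (μ k) (M k) A Aᶜ = 0) :
    spectralGap (tensorFun μ) (fun x y : Fin (K + 1) → S => t * ptGraphSwap μ e φ x y + (1 - t) * prodKernel w M x y)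
      ≤ t * min (∑ u ∈ A, μ 0 u) (∑ u ∈ Aᶜ, μ 0 u) / (m * v) := by
  have hKpos : (0 : ℝ) < K := Nat.cast_pos.mpr (by omega)
  have hmpos : (0 : ℝ) < m := Nat.cast_pos.mpr (by omega)
  have hmin0 : 0 ≤ min (∑ u ∈ A, μ 0 u) (∑ u ∈ Aᶜ, μ 0 u) :=
    le_min (sum_nonneg fun u _ => (hμ 0 u).le) (sum_nonneg fun u _ => (hμ 0 u).le)
  have hh : ((univ.filter fun r : Fin m => (e r).1 = 0 ∨ (e r).2 = 0).card : ℝ) ≤ K := by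
    exact_mod_cast hotDegree_le_of_simple he hsimple
  refine (dilutedHandover_spectralGap_le hK hm he hμ hμ1 hM hMrev hw0 hw1 ht0 ht1 hφA hvpos hv hidle).trans ?_
  calc t * ((univ.filter fun r : Fin m => (e r).1 = 0 ∨ (e r).2 = 0).card : ℝ)
          * min (∑ u ∈ A, μ 0 u) (∑ u ∈ Aᶜ, μ 0 u) / (m * K * v)
      ≤ t * K * min (∑ u ∈ A, μ 0 u) (∑ u ∈ Aᶜ, μ 0 u) / (m * K * v) :=
        div_le_div_of_nonneg_right (mul_le_mul_of_nonneg_right (mul_le_mul_of_nonneg_left hh ht0) hmin0)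
          (by positivity)
    _ = t * min (∑ u ∈ A, μ 0 u) (∑ u ∈ Aᶜ, μ 0 u) / (m * v) := by
        field_simp

/-! ## §4 The dilution law: simple graphs containing the hub, hot-only updates, one-sided domination -/

/-- **THE DILUTION LAW.**  A simple swap graph of `m` edges containing every hub edge `(0, k+1)`, identity maps, every
update spent on the hot replica (`w = 𝟙_{k=0}`), hot Poincaré constant `γ₀`, one-sided domination
`p·μ_{k+1} ≤ μ_0` (`0 < p ≤ 1`), `0 < t < 1`, and a sector `A` with `μ_k(A)μ_k(Aᶜ) ≥ v > 0` at the cold levels: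
**`p·min{t/(6m), γ₀(1−t)/(14K)} ≤ Gap(P) ≤ t·min{μ_0(A), μ_0(Aᶜ)}/(m·v)`** — the two sides agree in `m`: every
edge between two cold replicas costs linearly. [ours] -/
theorem simpleHubGraph_spectralGap_two_sided [Nontrivial S] (hK : 1 ≤ K) (hm : 1 ≤ m)
    (he : ∀ r, (e r).1 ≠ (e r).2)
    (hsimple : Function.Injective (fun r => ({(e r).1, (e r).2} : Finset (Fin (K + 1)))))
    (hhub : ∀ k : Fin K, ∃ j, e j = ((0 : Fin (K + 1)), k.succ)) (hμ : ∀ k x, 0 < μ k x)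
    (hμ1 : ∀ k, ∑ u, μ k u = 1) (hM : ∀ k, IsRowStochastic (M k)) (hMrev : ∀ k, DetailedBalance (μ k) (M k))
    (ht0 : 0 < t) (ht1 : t < 1) {p γ₀ : ℝ} (hp : 0 < p) (hp1 : p ≤ 1) (hγ₀ : 0 < γ₀)
    (hdom : ∀ (k : Fin K) (u : S), p * μ k.succ u ≤ μ 0 u)
    (hgap0 : ∀ g : S → ℝ, γ₀ * lawVariance (μ 0) g ≤ dirichletForm (μ 0) (M 0) g) {A : Finset S} {v : ℝ}
    (hvpos : 0 < v) (hv : ∀ k : Fin (K + 1), k ≠ 0 → v ≤ (∑ u ∈ A, μ k u) * ∑ u ∈ Aᶜ, μ k u) :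
    p * min (t / (6 * m)) (γ₀ * (1 - t) / (14 * K))
        ≤ spectralGap (tensorFun μ) (fun x y : Fin (K + 1) → S =>
            t * ptGraphSwap μ e (fun _ : Fin m => Equiv.refl S) x y
              + (1 - t) * prodKernel (fun k : Fin (K + 1) => if k = 0 then (1 : ℝ) else 0) M x y)
      ∧ spectralGap (tensorFun μ) (fun x y : Fin (K + 1) → S =>
            t * ptGraphSwap μ e (fun _ : Fin m => Equiv.refl S) x y
              + (1 - t) * prodKernel (fun k : Fin (K + 1) => if k = 0 then (1 : ℝ) else 0) M x y)
          ≤ t * min (∑ u ∈ A, μ 0 u) (∑ u ∈ Aᶜ, μ 0 u) / (m * v) := by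
  have hw0 : ∀ k : Fin (K + 1), 0 ≤ (if k = 0 then (1 : ℝ) else 0) := fun k => by positivity
  refine ⟨?_, ?_⟩
  · have h := oneSidedHub_spectralGap_ge (e := e) (w := fun k : Fin (K + 1) => if k = 0 then (1 : ℝ) else 0) hK hm
      he hhub hμ hμ1 hM hMrev hw0 hotOnlyWeight_sum (by simp) ht0 ht1 hp hp1 hγ₀ hdom hgap0
    simp only [if_true, mul_one] at h
    exact h
  · exact simpleGraph_spectralGap_le (φ := fun _ : Fin m => Equiv.refl S) hK hm he hsimple hμ hμ1 hM hMrev hw0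
      hotOnlyWeight_sum ht0.le ht1.le (fun _ _ => Iff.rfl) hvpos hv
      (fun k hk => by rw [if_neg hk, zero_mul])

/-- **THE COMPLETE SWAP GRAPH IS ORDER `K⁻²`, TWO-SIDED:** a simple graph with `2m = K(K+1)` entries on the `K+1`
levels (every pair once — in particular the hub), hot-only updates, one-sided domination:
**`p·min{t/(3K(K+1)), γ₀(1−t)/(14K)} ≤ Gap(P) ≤ 2t·min{μ_0(A), μ_0(Aᶜ)}/(K(K+1)·v)`**. [ours] -/
theorem completeGraph_spectralGap_two_sided [Nontrivial S] (hK : 1 ≤ K) (hm2 : 2 * m = K * (K + 1))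
    (he : ∀ r, (e r).1 ≠ (e r).2)
    (hsimple : Function.Injective (fun r => ({(e r).1, (e r).2} : Finset (Fin (K + 1)))))
    (hhub : ∀ k : Fin K, ∃ j, e j = ((0 : Fin (K + 1)), k.succ)) (hμ : ∀ k x, 0 < μ k x)
    (hμ1 : ∀ k, ∑ u, μ k u = 1) (hM : ∀ k, IsRowStochastic (M k)) (hMrev : ∀ k, DetailedBalance (μ k) (M k))
    (ht0 : 0 < t) (ht1 : t < 1) {p γ₀ : ℝ} (hp : 0 < p) (hp1 : p ≤ 1) (hγ₀ : 0 < γ₀)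
    (hdom : ∀ (k : Fin K) (u : S), p * μ k.succ u ≤ μ 0 u)
    (hgap0 : ∀ g : S → ℝ, γ₀ * lawVariance (μ 0) g ≤ dirichletForm (μ 0) (M 0) g) {A : Finset S} {v : ℝ}
    (hvpos : 0 < v) (hv : ∀ k : Fin (K + 1), k ≠ 0 → v ≤ (∑ u ∈ A, μ k u) * ∑ u ∈ Aᶜ, μ k u) :
    p * min (t / (3 * (K * (K + 1)))) (γ₀ * (1 - t) / (14 * K))
        ≤ spectralGap (tensorFun μ) (fun x y : Fin (K + 1) → S =>
            t * ptGraphSwap μ e (fun _ : Fin m => Equiv.refl S) x y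
              + (1 - t) * prodKernel (fun k : Fin (K + 1) => if k = 0 then (1 : ℝ) else 0) M x y)
      ∧ spectralGap (tensorFun μ) (fun x y : Fin (K + 1) → S =>
            t * ptGraphSwap μ e (fun _ : Fin m => Equiv.refl S) x y
              + (1 - t) * prodKernel (fun k : Fin (K + 1) => if k = 0 then (1 : ℝ) else 0) M x y)
          ≤ 2 * t * min (∑ u ∈ A, μ 0 u) (∑ u ∈ Aᶜ, μ 0 u) / (K * (K + 1) * v) := by
  have hKpos : (0 : ℝ) < K := Nat.cast_pos.mpr (by omega)
  have hm : 1 ≤ m := by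
    rcases Nat.eq_zero_or_pos m with h | h
    · subst h; nlinarith
    · exact h
  have hmr : (2 : ℝ) * m = K * (K + 1) := by exact_mod_cast hm2
  obtain ⟨h1, h2⟩ := simpleHubGraph_spectralGap_two_sided hK hm he hsimple hhub hμ hμ1 hM hMrev ht0 ht1 hp hp1 hγ₀
    hdom hgap0 hvpos hv
  refine ⟨?_, ?_⟩
  · have e1 : t / (3 * ((K : ℝ) * (K + 1))) = t / (6 * m) := by
      rw [← hmr]; ring
    rw [e1]; exact h1
  · have e2 : 2 * t * min (∑ u ∈ A, μ 0 u) (∑ u ∈ Aᶜ, μ 0 u) / (K * (K + 1) * v)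
        = t * min (∑ u ∈ A, μ 0 u) (∑ u ∈ Aᶜ, μ 0 u) / (m * v) := by
      rw [← hmr]; field_simp
    rw [e2]; exact h2

end Summit.Ventures.LatticeQCDFlow.Scaling

end
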